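/-
Copyright: the b2b-balaban T⁴-continuum CRUX team, row NE7b owner lineage `t4-ne7b-p1` (gen 113). Project licence.
-/
import Summits.QuantumFields.BalabanUV.Beta.D1BFx.PointColumnSplit

/-!
# UNIQUENESS IN THE SUP CURRENCY (Liouville for the fibre equation): for the scalar block-averaging step on `ℤ^d`
# (`A = Δ^η + aQ′*Q′`, block side `n + 1`, EVERY `d`, `n`, `a > 0`), a BOUNDED fine field `φ` whose image under `A` is
# BLOCK-CONSTANT (`Aφ = Q′*c`) and whose block sums all vanish (`Q′φ = 0`) is identically zero — so the augmented system
# `Q′φ = k`, `Aφ ≡ ψ (mod range Q′*)` has AT MOST ONE bounded solution: together with (51)'s `φ = Hk + Γψ` the inverse augmented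
# operator of the Gaussian skeleton on `ℓ^∞(ℤ^d)` is determined (row NE7b, node U5c; `B5Hk103ScalarZd` + the β-team's
# `PointColumnSplit.tsum_Gk_AX_apply` BY NAME; [folklore] bookkeeping)

Cell `pub-balaban`, sub-cell `t4`, spine estimate NE7b (`T4WeightBudget.RelWeightBound`; the cell's OWN estimate — NOT PRINTED
in [Bałaban 1983–89], NOT PROVED).  Crux-route work under `Spine/NE7b/` by the row OWNER (`t4-ne7b-p1` gen 113) under FREEZE
(0)'s crux-prover clause (RULING W-ne7bp1-g113-1, FILING-CLAIM C-ne7bp1-g113-7); NOTHING of Bałaban's is asserted; no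
`T4Continuum/Support` leaf typed; no `def`; zero `sorry`.  Imports (BY NAME): the β-team's `D1BFx/PointColumnSplit` (`tsum_Gk_AX_apply`:
`G′·(Ah) = h` for every BOUNDED `h`) and through it the Literature columns `B6QGQLower276` (`AX`, `abs_AX_le`, `c0`, blocks),
`B6QGQDecay237` (`cU`, `deltaU`, `abs_kerQGQ_le_unif`, `cInv`, `deltaInv`), `B5Hk103ScalarZd` (`Gk`, `gq`, `Kinv`, `kerQGQ` via
`B6QGQLower276`, `tsum_AX_mul`, `tsum_blocks`, `tsum_mul_tsum_comm`, `tsum_Kinv_mul_kerQGQ`, `summable_Gk_row`, `abs_Kinv_le`).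

WHY.  (51) `…FibreInverseSupNorm` EXHIBITS a bounded solution `φ = Hk + Γψ` of the augmented system with the sup letter
`‖φ‖_∞ ≤ C_∞‖k‖_∞ + A_G K_d(1 + C_∞)‖ψ‖_∞`; for HSCR's `T` to be an EQUIVALENCE on the sup-currency carrier one also needs
that no other bounded solution exists.  On `ℓ²` this is the tree's `B5Hk103Minimizer.eq_zero_of_energy_eq_zero` ∕ `B5Hk165L2Zd`
uniqueness; on `ℓ^∞` it is a Liouville statement, and it follows from three identities the tree already holds: `G′·(Aφ) = φ` for
bounded `φ` (`tsum_Gk_AX_apply`) turns `Aφ = Q′*c` into `φ = G′Q′*c` (`c` is bounded because `A` has bounded rows); the zero block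
sums then say `(Q′G′Q′*)c = 0`; and `(Q′G′Q′*)⁻¹(Q′G′Q′*) = 1` entrywise (`tsum_Kinv_mul_kerQGQ`, Fubini under exponential
majorants) gives `c = 0`, whence `φ = G′·0 = 0`.

WHAT IS PROVED ([folklore]; EVERY `d`, `n : ℕ`, `a > 0`):
* §1 `exists_mem_block` (every block is inhabited: `blk (chart y 0) = y`), `abs_sum_AX_mul_le` (`|Σ_r A(p,r)φ(r)| ≤ c0·K_d(1)·M` for `|φ| ≤ M`
  — `A` is bounded on `ℓ^∞`, side-dependent constant, harmless here), `abs_multiplier_le` (`Aφ = Q′*c` ⟹ `|c| ≤ c0·K_d(1)·M`).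
* §2 `eq_tsum_gq_mul_of_AX_blockConst` (**`φ = G′Q′*c`**: `φ(p) = Σ′_y (G′Q′*)(p,y)·c(y)`), `sum_B_gq` (`Σ_{p∈B(z)}(G′Q′*)(p,y) =
  (n+1)^d·(Q′G′Q′*)(z,y)`), `tsum_kerQGQ_mul_eq_zero_of_blockSums` (`Q′φ = 0` ⟹ `(Q′G′Q′*)c = 0`).
* §3 `multiplier_eq_zero` (`c = 0`), **`eq_zero_of_bounded_fibre_solution`** — THE LIOUVILLE STATEMENT: `|φ| ≤ M`, `Aφ = Q′*c`, `Q′φ = 0`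
  ⟹ `φ = 0`; **`augmented_unique`** (two bounded solutions of `Q′φ = k`, `Aφ ≡ ψ (mod Q′*)` coincide).
* §4 toy.

HONEST (what this is NOT).  No constants of interest (qualitative uniqueness); scalar `ℤ^d`; the `ℓ^∞`-operator packaging of `T` as an
`≃L` is not typed; nothing of the covariant operators ((A3), NC-NE7b-α UNRULED).  BY-NAME EFFECT ON THE WALL: NONE.  NE7b NOT PRINTED ∕
NOT PROVED; spine PROVED 0∕9; rung (B)+1 on a FINITE torus — NOT infinite volume, NOT the mass gap, NOT Clay.  HONEST DEPENDENCY: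
continuum YM on T⁴ ⇐ BetaPertH ∧ nine spine estimates (0∕9 proved); BetaPertH ⇐ (D1) ∧ (D4) ∧ CAP+tail; G-an2-4 gates asym, D1 and
NE2∕3∕4.
-/

set_option autoImplicit false

namespace Summit.QuantumFields.BalabanUV.T4Continuum.NE7b.FibreSupUniqueness

open Finset Real
open Literature.MathematicalPhysics.QuantumFieldTheory.Balaban1983to89
open B4Sect5Proof (latticeConst latticeConst_nonneg)
open B6QGQLower276 (X blk B mem_B sum_B_const AX chart blk_chart abs_AX_le c0 c0_pos kerQGQ)
open B6QGQDecay237 (cU cU_pos deltaU deltaU_pos abs_kerQGQ_le_unif cInv cInv_pos deltaInv deltaInv_pos)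
open B5Hk103ScalarZd (Gk gq Kinv nbhd summable_expX tsum_expX_le tsum_AX_mul tsum_blocks summable_blocks summable_Gk_row
  tsum_mul_tsum_comm tsum_Kinv_mul_kerQGQ abs_Kinv_le)
open Summit.QuantumFields.BalabanUV.Beta.D1BFx.PointColumnSplit (tsum_Gk_AX_apply)

noncomputable section

variable {d : ℕ}

/-! ## §1. `A` is bounded on `ℓ^∞`; the multiplier of a bounded field is bounded -/

/-- Every block is inhabited: `blk (chart y 0) = y`. [folklore] -/
theorem exists_mem_block (n : ℕ) (y : X d) : ∃ p : X d, blk n p = y := ⟨chart n y 0, blk_chart n y 0⟩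

/-- `|Σ_{r∈nbhd p} A(p,r)φ(r)| ≤ c0(d,n,a)·K_d(1)·M` for `|φ| ≤ M`: the site matrix is bounded on `ℓ^∞` (side-dependent constant —
only finiteness is used below). [folklore] -/
theorem abs_sum_AX_mul_le (n : ℕ) {a : ℝ} (ha : 0 < a) {φ : X d → ℝ} {M : ℝ} (hφ : ∀ r, |φ r| ≤ M) (p : X d) :
    |∑ r ∈ nbhd n p, AX n a p r * φ r| ≤ c0 d n a * latticeConst d 1 * M := by
  have hM : 0 ≤ M := (abs_nonneg _).trans (hφ p)
  have hc := c0_pos d n ha.ne'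
  rw [← tsum_AX_mul n a p φ]
  have hsum : HasSum (fun r : X d => c0 d n a * M * Real.exp (-(1 * dist p r)))
      (c0 d n a * M * ∑' r : X d, Real.exp (-(1 * dist p r))) := (summable_expX one_pos p).hasSum.mul_left _
  have h := tsum_of_norm_bounded hsum fun r => by
    rw [Real.norm_eq_abs, abs_mul]
    calc |AX n a p r| * |φ r| ≤ (c0 d n a * Real.exp (-(1 * dist p r))) * M :=
          mul_le_mul (abs_AX_le n a p r) (hφ r) (abs_nonneg _) (by positivity)
      _ = c0 d n a * M * Real.exp (-(1 * dist p r)) := by ring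
  rw [Real.norm_eq_abs] at h
  calc _ ≤ c0 d n a * M * ∑' r : X d, Real.exp (-(1 * dist p r)) := h
    _ ≤ c0 d n a * M * latticeConst d 1 := mul_le_mul_of_nonneg_left (tsum_expX_le one_pos p) (by positivity)
    _ = c0 d n a * latticeConst d 1 * M := by ring

/-- If `Aφ = Q′*c` with `|φ| ≤ M` then the multiplier is bounded: `|c(y)| ≤ c0·K_d(1)·M`. [folklore] -/
theorem abs_multiplier_le (n : ℕ) {a : ℝ} (ha : 0 < a) {φ c : X d → ℝ} {M : ℝ} (hφ : ∀ r, |φ r| ≤ M)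
    (hA : ∀ p : X d, ∑ r ∈ nbhd n p, AX n a p r * φ r = c (blk n p)) (y : X d) :
    |c y| ≤ c0 d n a * latticeConst d 1 * M := by
  obtain ⟨p, hp⟩ := exists_mem_block n y
  rw [← hp, ← hA p]
  exact abs_sum_AX_mul_le n ha hφ p

/-! ## §2. `φ = G′Q′*c` and `(Q′G′Q′*)c = 0` -/

/-- **`φ = G′Q′*c`**: a bounded `φ` with `Aφ = Q′*c` equals `p ↦ Σ′_y (G′Q′*)(p,y)·c(y)` (`G′·(Aφ) = φ`, `tsum_Gk_AX_apply`; then the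
row of `G′` is regrouped block by block, `tsum_blocks`). [folklore] -/
theorem eq_tsum_gq_mul_of_AX_blockConst (n : ℕ) {a : ℝ} (ha : 0 < a) {φ c : X d → ℝ} {M : ℝ} (hφ : ∀ r, |φ r| ≤ M)
    (hA : ∀ p : X d, ∑ r ∈ nbhd n p, AX n a p r * φ r = c (blk n p)) (p : X d) :
    φ p = ∑' y : X d, gq n a p y * c y := by
  have hC := abs_multiplier_le n ha hφ hA
  set C := c0 d n a * latticeConst d 1 * M with hCdef
  have h1 : φ p = ∑' r : X d, Gk n a p r * c (blk n r) := by
    rw [← tsum_Gk_AX_apply n ha p φ hφ]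
    exact tsum_congr fun r => by rw [tsum_AX_mul n a r φ, hA r]
  have hs : Summable fun r : X d => Gk n a p r * c (blk n r) := by
    refine Summable.of_norm_bounded ((summable_Gk_row n ha p).abs.mul_right C) fun r => ?_
    rw [Real.norm_eq_abs, abs_mul]
    exact mul_le_mul_of_nonneg_left (hC (blk n r)) (abs_nonneg _)
  rw [h1, ← tsum_blocks n hs]
  refine tsum_congr fun y => ?_
  rw [gq, Finset.sum_mul]
  exact Finset.sum_congr rfl fun r hr => by rw [mem_B.1 hr]

/-- `Σ_{p∈B(z)} (G′Q′*)(p,y) = (n+1)^d·(Q′G′Q′*)(z,y)` (the definition of `kerQGQ`). [folklore] -/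
theorem sum_B_gq (n : ℕ) (a : ℝ) (z y : X d) : ∑ p ∈ B n z, gq n a p y = ((n : ℝ) + 1) ^ d * kerQGQ n a z y := by
  have hsd : (0 : ℝ) < ((n : ℝ) + 1) ^ d := by positivity
  unfold kerQGQ gq
  rw [← mul_assoc, mul_inv_cancel₀ hsd.ne', one_mul]
  rfl

/-- **`Q′φ = 0` ⟹ `(Q′G′Q′*)c = 0`**: if moreover every block sum of `φ` vanishes then `Σ′_y (Q′G′Q′*)(z,y)·c(y) = 0` for every `z`. [folklore] -/
theorem tsum_kerQGQ_mul_eq_zero_of_blockSums (n : ℕ) {a : ℝ} (ha : 0 < a) {φ c : X d → ℝ} {M : ℝ} (hφ : ∀ r, |φ r| ≤ M)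
    (hA : ∀ p : X d, ∑ r ∈ nbhd n p, AX n a p r * φ r = c (blk n p)) (hQ : ∀ z : X d, ∑ p ∈ B n z, φ p = 0) (z : X d) :
    ∑' y : X d, kerQGQ n a z y * c y = 0 := by
  have hC := abs_multiplier_le n ha hφ hA
  set C := c0 d n a * latticeConst d 1 * M with hCdef
  have hsd : (0 : ℝ) < ((n : ℝ) + 1) ^ d := by positivity
  have hs : ∀ p ∈ B n z, Summable fun y : X d => gq n a p y * c y := by
    intro p _
    have hrow : Summable fun y : X d => gq n a p y := by
      have := summable_blocks n (summable_Gk_row n ha p)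
      exact this.congr fun y => by rw [gq]
    refine Summable.of_norm_bounded (hrow.abs.mul_right C) fun y => ?_
    rw [Real.norm_eq_abs, abs_mul]
    exact mul_le_mul_of_nonneg_left (hC y) (abs_nonneg _)
  have h1 : ∑ p ∈ B n z, φ p = ∑' y : X d, ((n : ℝ) + 1) ^ d * (kerQGQ n a z y * c y) := by
    calc ∑ p ∈ B n z, φ p = ∑ p ∈ B n z, ∑' y : X d, gq n a p y * c y :=
          Finset.sum_congr rfl fun p _ => eq_tsum_gq_mul_of_AX_blockConst n ha hφ hA p
      _ = ∑' y : X d, ∑ p ∈ B n z, gq n a p y * c y := (Summable.tsum_finsetSum hs).symm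
      _ = ∑' y : X d, ((n : ℝ) + 1) ^ d * (kerQGQ n a z y * c y) := by
          refine tsum_congr fun y => ?_
          rw [← Finset.sum_mul, sum_B_gq]; ring
  rw [hQ z, tsum_mul_left] at h1
  exact (mul_eq_zero.1 h1.symm).resolve_left hsd.ne'

/-! ## §3. The multiplier vanishes, hence the field: Liouville for the fibre equation in `ℓ^∞` -/

/-- **`c = 0`**: `(Q′G′Q′*)⁻¹(Q′G′Q′*) = 1` entrywise (`tsum_Kinv_mul_kerQGQ`) applied to the bounded `c` through Fubini under the majorant
`c_inv e^{−δ_inv|y′−z|}·c_u e^{−δ_u|z−y|}·‖c‖_∞`. [folklore] -/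
theorem multiplier_eq_zero (n : ℕ) {a : ℝ} (ha : 0 < a) {φ c : X d → ℝ} {M : ℝ} (hφ : ∀ r, |φ r| ≤ M)
    (hA : ∀ p : X d, ∑ r ∈ nbhd n p, AX n a p r * φ r = c (blk n p)) (hQ : ∀ z : X d, ∑ p ∈ B n z, φ p = 0) (y' : X d) :
    c y' = 0 := by
  classical
  have hC := abs_multiplier_le n ha hφ hA
  set C := c0 d n a * latticeConst d 1 * M with hCdef
  have hC0 : 0 ≤ C := (abs_nonneg _).trans (hC y')
  have hswap := tsum_mul_tsum_comm (f := fun z => Kinv n a y' z) (g := fun z y => kerQGQ n a z y * c y)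
    (C := cInv d a * cU d a * C) (deltaInv_pos d ha) (deltaU_pos d ha) y' (fun z y => by
      rw [abs_mul, abs_mul]
      calc |Kinv n a y' z| * (|kerQGQ n a z y| * |c y|)
          ≤ (cInv d a * Real.exp (-(deltaInv d a * dist y' z))) * ((cU d a * Real.exp (-(deltaU d a * dist z y))) * C) :=
            mul_le_mul (abs_Kinv_le n ha y' z) (mul_le_mul (abs_kerQGQ_le_unif n ha z y) (hC y) (abs_nonneg _)
              (by have := cU_pos d ha; positivity)) (by positivity) (by have := cInv_pos d ha; positivity)
        _ = cInv d a * cU d a * C * Real.exp (-(deltaInv d a * dist y' z)) * Real.exp (-(deltaU d a * dist z y)) := by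
            ring)
  have hzero : ∑' z : X d, Kinv n a y' z * ∑' y : X d, kerQGQ n a z y * c y = 0 := by
    rw [tsum_congr fun z => by rw [tsum_kerQGQ_mul_eq_zero_of_blockSums n ha hφ hA hQ z]]
    simp
  rw [hswap] at hzero
  have hinner : ∀ y : X d, ∑' z : X d, Kinv n a y' z * (kerQGQ n a z y * c y) = (if y' = y then 1 else 0) * c y := by
    intro y
    rw [← tsum_Kinv_mul_kerQGQ n ha y' y, ← tsum_mul_right]
    exact tsum_congr fun z => by ring
  rw [tsum_congr hinner, tsum_eq_single y' (fun y hy => by rw [if_neg (Ne.symm hy), zero_mul]), if_pos rfl, one_mul]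
    at hzero
  exact hzero

/-- **LIOUVILLE FOR THE FIBRE EQUATION IN `ℓ^∞`** (every `d`): a bounded fine field with block-constant `Aφ` and vanishing block sums is zero.
[folklore] -/
theorem eq_zero_of_bounded_fibre_solution (n : ℕ) {a : ℝ} (ha : 0 < a) {φ c : X d → ℝ} {M : ℝ} (hφ : ∀ r, |φ r| ≤ M)
    (hA : ∀ p : X d, ∑ r ∈ nbhd n p, AX n a p r * φ r = c (blk n p)) (hQ : ∀ z : X d, ∑ p ∈ B n z, φ p = 0) (p : X d) :
    φ p = 0 := by
  rw [eq_tsum_gq_mul_of_AX_blockConst n ha hφ hA p]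
  rw [tsum_congr fun y => by rw [multiplier_eq_zero n ha hφ hA hQ y]]
  simp

/-- **UNIQUENESS OF THE AUGMENTED SYSTEM ON `ℓ^∞`** (every `d`): two bounded fine fields with the same block sums whose images under
`A` differ by a block-constant field coincide.  With (51)'s `φ = Hk + Γψ` this pins down the inverse augmented operator of the
Gaussian skeleton in the sup currency. [folklore] -/
theorem augmented_unique (n : ℕ) {a : ℝ} (ha : 0 < a) {φ₁ φ₂ c₁ c₂ ψ : X d → ℝ} {M₁ M₂ : ℝ} (h₁ : ∀ r, |φ₁ r| ≤ M₁)
    (h₂ : ∀ r, |φ₂ r| ≤ M₂)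
    (hA₁ : ∀ p : X d, ∑ r ∈ nbhd n p, AX n a p r * φ₁ r = ψ p + c₁ (blk n p))
    (hA₂ : ∀ p : X d, ∑ r ∈ nbhd n p, AX n a p r * φ₂ r = ψ p + c₂ (blk n p))
    (hQ : ∀ z : X d, ∑ p ∈ B n z, φ₁ p = ∑ p ∈ B n z, φ₂ p) : φ₁ = φ₂ := by
  funext p
  have hφ : ∀ r, |(φ₁ - φ₂) r| ≤ M₁ + M₂ := fun r => by
    rw [Pi.sub_apply]; exact (abs_sub _ _).trans (add_le_add (h₁ r) (h₂ r))
  have hA : ∀ q : X d, ∑ r ∈ nbhd n q, AX n a q r * (φ₁ - φ₂) r = (c₁ - c₂) (blk n q) := by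
    intro q
    simp only [Pi.sub_apply, mul_sub, Finset.sum_sub_distrib, hA₁ q, hA₂ q]
    ring
  have hQ' : ∀ z : X d, ∑ q ∈ B n z, (φ₁ - φ₂) q = 0 := by
    intro z
    simp only [Pi.sub_apply, Finset.sum_sub_distrib, hQ z, sub_self]
  have h := eq_zero_of_bounded_fibre_solution n ha hφ hA hQ' p
  rw [Pi.sub_apply] at h
  linarith

/-! ## §4. Toy -/

/-- Toy: the uniqueness mechanism in one line of arithmetic — if `x = g·c` (here `φ = G′Q′*c`), `q·x = 0` (zero block sums) and `k·(q·g) = 1`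
(`(Q′G′Q′*)⁻¹(Q′G′Q′*) = 1`), then `c = k·(q·g)·c = k·(q·x) = 0`. -/
example (x g c q k : ℝ) (hx : x = g * c) (hq : q * x = 0) (hk : k * (q * g) = 1) : c = 0 := by
  have : c = k * (q * x) := by rw [hx, ← mul_assoc q, ← mul_assoc, hk, one_mul]
  rw [this, hq, mul_zero]

end

end Summit.QuantumFields.BalabanUV.T4Continuum.NE7b.FibreSupUniqueness
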